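import Literature.Analysis.FunctionSpaces.UniformlyConvexLogSobolev
import Literature.Probability.Moments.HerbstArgument
import Summits.QuantumFields.YangMills.Theorems.BalabanUVNodesN14CovGradEngine

/-!
# BalabanUVNodes ∕ node N14 = NE1′ — THE CONVEX-FIBRE ENGINE: an entropy (log-Sobolev) constant of the fibre law — in particular a
# uniform convexity modulus of the fibre action — pays the born dressed cumulant in GRADIENT currency (Herbst) and the variance

Cell `pub-ymgap`, HUMAN RULING D-0062 (Track A at full width), seat `pub-ymgap-dag-n14-c` (R134 ACCELERATION, strategy s1), generation 4;
route `Summits/QuantumFields/YangMills/Theses/BalabanUVNodes.lean` (cluster K3′ `SpineGivenEndpointR12`, `--supports … --as helper`); venue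
ruling R424 (`YangMills/Theorems`, namespace `YMDAG.N14.ConvexFibreEngine`).  Generation 3's successor door (i) («turn the hypothesis SHAPES
of `…N14CovGradEngine` ∕ `…N14VarianceSocket` into theorems for finite-dimensional uniformly log-concave fibre laws»), made actionable by the
literature desk's answer to ME #14 (lit-balaban iface-1, bus l.14464): HERBST and the BAKRY–ÉMERY entropy inequality are PROVED in the
tree; «the only glue left is the test class — OUR glue, Summits-side».  ADDITIVE — imports the PROVED Literature files
`Literature/Analysis/FunctionSpaces/UniformlyConvexLogSobolev` (`entropy_exp_le_of_uniformlyConvex`, Bobkov–Ledoux's form of Bakry–Émery for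
`φ ∈ C¹_c`; through it `…/BrascampLiebVarianceViaPrekopaLeindler.variance_tilted_le`), `Literature/Probability/Moments/HerbstArgument`
(`hasSubgaussianMGF_of_entropy_le`) and generation 3's `…N14CovGradEngine` (`bornCumulant_le_of_hasSubgaussianMGF`, card 1 C1-a); THEOREMS
ONLY (0 `def`), modifies nothing.  Sequel: `…N14ConvexFibreWindow` (tilt stability on the source window, the variance socket, the tower).

SETTING.  A probability law `ν` on `EuclideanSpace ℝ (Fin n)` with the `C¹_c` ENTROPY SCHEMA of constant `C`:
`∀ φ ∈ C¹_c, ∫ φe^φ dν − (∫e^φ dν)·log ∫e^φ dν ≤ (C∕2)∫‖Dφ‖²e^φ dν` (displayed inline; it IS the convex-domain port's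
`HasEntropyExpC1c ν C`, node00-def-RR-2, whose Bobkov–Ledoux named facts then feed §1–§2 for the small-field BOXES by name); the model case
`ν = volume.tilted (−V)`, `V` continuous and `λ`-UNIFORMLY CONVEX in the tree's first-order letter `V x + ⟪∇V x, y − x⟫ + (λ∕2)‖y − x‖² ≤ V y`,
has the schema with `C = 1∕λ` (§3).  Observable `G ∈ C¹` with `|G| ≤ B` and GRADIENT SIZE `‖DG‖ ≤ L`.

WHAT THIS IS.
* §1 THE GLUE (the desk's «ours»): `entropy_exp_le_of_entropyC1c` extends the schema from `φ ∈ C¹_c` to BOUNDED `φ ∈ C¹` WITH BOUNDED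
  DERIVATIVE (truncations `χ(x∕R)·φ` + dominated convergence).
* §2 HERBST UNDER THE SCHEMA [cite: BakryGentilLedoux2014, Prop. 5.4.1 — PROVED in the tree]: `entropy_exp_mul_le_of_entropyC1c`
  (`Ent_ν(e^{lG}) ≤ (C·L²∕2)·l²·∫e^{lG} dν` ∀ l — EXACTLY Herbst's hypothesis); **`hasSubgaussianMGF_of_entropyC1c`** (`HasSubgaussianMGF
  (G − ∫G dν) ⟨C·L²⟩ ν` — card 1 C1-a's INPUT PRODUCED); **`bornCumulant_le_of_entropyC1c`** (`cgf G ν t − t·∫G dν ≤ (C·L²)·t²∕2` ∀ t):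
  the born dressed term is SECOND ORDER in the source with the GRADIENT constant — in place of the SUP-currency `2B²e^{6(s+|t|B)}·t²` of
  `(1.75)ₜ` (`B16DressedActionTerm.norm_dressLog_sub_linear_le`); the letter in which a depth-`k` fibre's observable is `θ₁^k`-small.
* §3 THE UNIFORMLY LOG-CONCAVE LAW [cite: BakryGentilLedoux2014, Cor. 5.7.2; BrascampLieb1976, Thm 4.1 — both PROVED in the tree]:
  `entropyC1c_of_uniformlyConvex` (schema, `C = 1∕λ`), **`hasSubgaussianMGF_of_uniformlyConvex`** (parameter `L²∕λ`),
  **`bornCumulant_le_of_uniformlyConvex`** (`≤ (L²∕λ)·t²∕2`), `variance_le_of_uniformlyConvex` (`Var[G; ν] ≤ λ⁻¹·L²`, the scalar one-bond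
  case of `CovGradEngine.var_le_of_covGradBound`'s currency).

WHAT THIS IS NOT.  Everything here is PROVED (0 `sorry`, 0 named-fact hypotheses); the HYPOTHESIS in any application is the schema for —
i.e. the uniform convexity of — Bałaban's history-conditioned small-field fibre actions on their boxes, stably under the source tilt (NODE O's
located POSITIVITY statement, [Balaban1988RGII] (1.1)∕(2.20)-KIND).  Nothing of Bałaban's instantiated; `CovGradBound`'s per-bond kernel
(Helffer–Sjöstrand) NOT produced; N14 NOT discharged; count-neutral.  One finite four-torus programme at fixed ε; NOT ℝ⁴∕OS∕mass gap∕Clay.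
-/

noncomputable section

namespace YMDAG.N14.ConvexFibreEngine

open MeasureTheory ProbabilityTheory Set Filter Topology InnerProductSpace
open scoped RealInnerProductSpace ENNReal NNReal
open Literature.Analysis.FunctionSpaces (entropy_exp_le_of_uniformlyConvex isProbabilityMeasure_tilted_neg integrable_of_norm_le_const)
open Literature.Probability.Moments (hasSubgaussianMGF_of_entropy_le variance_tilted_le)
open YMDAG.N14.CovGradEngine (bornCumulant_le_of_hasSubgaussianMGF)

variable {n : ℕ}

/-! ## §1 The glue: the Bakry–Émery entropy inequality for bounded `C¹` test functions with bounded derivative -/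
section Glue

/-- Smooth cutoffs `ψ_R(x) = χ(x∕R)` from a fixed bump `χ` (`= 1` on the unit ball, supported in the ball of radius `2`): `C¹`, compact
support, values in `[0,1]`, `ψ_R = 1` on `‖x‖ ≤ R`, `‖Dψ_R‖ ≤ K∕R` (adapted from the BL file's private `exists_cutoff`). [folklore] -/
private theorem exists_cutoff (n : ℕ) :
    ∃ (ψ : ℝ → EuclideanSpace ℝ (Fin n) → ℝ) (K : ℝ), 0 ≤ K ∧ ∀ R : ℝ, 1 ≤ R →
      ContDiff ℝ 1 (ψ R) ∧ HasCompactSupport (ψ R) ∧ (∀ x, 0 ≤ ψ R x) ∧ (∀ x, ψ R x ≤ 1) ∧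
      (∀ x, ‖x‖ ≤ R → ψ R x = 1) ∧ (∀ x, ‖fderiv ℝ (ψ R) x‖ ≤ K / R) := by
  let χ : ContDiffBump (0 : EuclideanSpace ℝ (Fin n)) := ⟨1, 2, by norm_num, by norm_num⟩
  have hχ : ContDiff ℝ 1 χ := χ.contDiff
  have hDc : Continuous (fderiv ℝ χ) := hχ.continuous_fderiv one_ne_zero
  obtain ⟨K, hK⟩ := hDc.bounded_above_of_compact_support (χ.hasCompactSupport.fderiv (𝕜 := ℝ))
  have hK0 : 0 ≤ K := (norm_nonneg _).trans (hK 0)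
  refine ⟨fun R x => χ (R⁻¹ • x), K, hK0, fun R hR => ?_⟩
  have hR0 : 0 < R := by linarith
  have hnorm : ∀ x : EuclideanSpace ℝ (Fin n), ‖R⁻¹ • x‖ = ‖x‖ / R := fun x => by
    rw [norm_smul, Real.norm_eq_abs, abs_of_pos (inv_pos.2 hR0), div_eq_inv_mul]
  have hderiv : ∀ x, HasFDerivAt (fun x => χ (R⁻¹ • x))
      ((fderiv ℝ χ (R⁻¹ • x)).comp (R⁻¹ • ContinuousLinearMap.id ℝ _)) x := fun x =>
    (hχ.differentiable one_ne_zero (R⁻¹ • x)).hasFDerivAt.comp x ((hasFDerivAt_id x).const_smul R⁻¹)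
  refine ⟨hχ.comp (contDiff_const_smul R⁻¹), ?_, fun x => χ.nonneg, fun x => χ.le_one, ?_, ?_⟩
  · refine HasCompactSupport.intro (isCompact_closedBall (0 : EuclideanSpace ℝ (Fin n)) (2 * R)) fun x hx => ?_
    apply χ.zero_of_le_dist
    rw [Metric.mem_closedBall, dist_zero_right, not_le] at hx
    show (2 : ℝ) ≤ dist (R⁻¹ • x) 0
    rw [dist_zero_right, hnorm, le_div_iff₀ hR0]
    linarith
  · intro x hx
    apply χ.one_of_mem_closedBall
    show R⁻¹ • x ∈ Metric.closedBall 0 (1 : ℝ)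
    rw [Metric.mem_closedBall, dist_zero_right, hnorm, div_le_one hR0]
    exact hx
  · intro x
    rw [(hderiv x).fderiv]
    calc ‖(fderiv ℝ χ (R⁻¹ • x)).comp (R⁻¹ • ContinuousLinearMap.id ℝ _)‖
        ≤ ‖fderiv ℝ χ (R⁻¹ • x)‖ * ‖R⁻¹ • ContinuousLinearMap.id ℝ (EuclideanSpace ℝ (Fin n))‖ :=
          ContinuousLinearMap.opNorm_comp_le _ _
      _ ≤ K * R⁻¹ := by
          refine mul_le_mul (hK _) ?_ (norm_nonneg _) hK0
          rw [norm_smul, Real.norm_eq_abs, abs_of_pos (inv_pos.2 hR0)]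
          exact mul_le_of_le_one_right (inv_pos.2 hR0).le ContinuousLinearMap.norm_id_le
      _ = K / R := by rw [div_eq_mul_inv]

/-- Domination bound for the derivative of a truncation `χ·φ` (`0 ≤ χ ≤ 1`, `‖Dχ‖ ≤ K'`): `‖D(χφ)‖² ≤ 2‖Dφ‖² + 2K'²φ²`. [folklore] -/
private theorem norm_fderiv_cutoff_mul_sq_le {χ φ : EuclideanSpace ℝ (Fin n) → ℝ} {K' : ℝ} {x : EuclideanSpace ℝ (Fin n)}
    (hχd : DifferentiableAt ℝ χ x) (hφd : DifferentiableAt ℝ φ x) (h0 : 0 ≤ χ x) (h1 : χ x ≤ 1) (hD : ‖fderiv ℝ χ x‖ ≤ K') :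
    ‖fderiv ℝ (fun y => χ y * φ y) x‖ ^ 2 ≤ 2 * ‖fderiv ℝ φ x‖ ^ 2 + 2 * K' ^ 2 * φ x ^ 2 := by
  rw [fderiv_fun_mul hχd hφd]
  have hA : ‖χ x • fderiv ℝ φ x‖ ≤ ‖fderiv ℝ φ x‖ := by
    rw [norm_smul, Real.norm_eq_abs, abs_of_nonneg h0]
    exact mul_le_of_le_one_left (norm_nonneg _) h1
  have hB : ‖φ x • fderiv ℝ χ x‖ ≤ K' * |φ x| := by
    rw [norm_smul, Real.norm_eq_abs, mul_comm]
    exact mul_le_mul_of_nonneg_right hD (abs_nonneg _)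
  have hs := norm_add_le (χ x • fderiv ℝ φ x) (φ x • fderiv ℝ χ x)
  have ht : ‖χ x • fderiv ℝ φ x + φ x • fderiv ℝ χ x‖ ≤ ‖fderiv ℝ φ x‖ + K' * |φ x| := by linarith
  have h2 := pow_le_pow_left₀ (norm_nonneg _) ht 2
  have h3 : (‖fderiv ℝ φ x‖ + K' * |φ x|) ^ 2 ≤ 2 * ‖fderiv ℝ φ x‖ ^ 2 + 2 * K' ^ 2 * φ x ^ 2 := by
    rw [← sq_abs (φ x)] ; nlinarith [sq_nonneg (‖fderiv ℝ φ x‖ - K' * |φ x|)]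
  exact h2.trans h3

/-- Pointwise facts about the truncations `φ_k = ψ_{k+1}·φ`: `φ_k → φ`, `‖Dφ_k‖ → ‖Dφ‖`, `|φ_k| ≤ |φ|`, and
`‖Dφ_k‖² ≤ 2‖Dφ‖² + 2K²φ²` (adapted from the BL file's private `truncation_pointwise`). [folklore] -/
private theorem truncation_pointwise {ψ : ℝ → EuclideanSpace ℝ (Fin n) → ℝ} {K : ℝ} (hK0 : 0 ≤ K)
    (hψ : ∀ R : ℝ, 1 ≤ R →
      ContDiff ℝ 1 (ψ R) ∧ HasCompactSupport (ψ R) ∧ (∀ x, 0 ≤ ψ R x) ∧ (∀ x, ψ R x ≤ 1) ∧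
      (∀ x, ‖x‖ ≤ R → ψ R x = 1) ∧ (∀ x, ‖fderiv ℝ (ψ R) x‖ ≤ K / R))
    {φ : EuclideanSpace ℝ (Fin n) → ℝ} (hφ : ContDiff ℝ 1 φ) (x : EuclideanSpace ℝ (Fin n)) :
    Tendsto (fun k : ℕ => ψ ((k : ℝ) + 1) x * φ x) atTop (𝓝 (φ x)) ∧
    Tendsto (fun k : ℕ => ‖fderiv ℝ (fun y => ψ ((k : ℝ) + 1) y * φ y) x‖) atTop (𝓝 ‖fderiv ℝ φ x‖) ∧
    (∀ k : ℕ, |ψ ((k : ℝ) + 1) x * φ x| ≤ |φ x|) ∧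
    (∀ k : ℕ, ‖fderiv ℝ (fun y => ψ ((k : ℝ) + 1) y * φ y) x‖ ^ 2 ≤ 2 * ‖fderiv ℝ φ x‖ ^ 2 + 2 * K ^ 2 * φ x ^ 2) := by
  have hφd : Differentiable ℝ φ := hφ.differentiable one_ne_zero
  have hk1 : ∀ k : ℕ, (1 : ℝ) ≤ (k : ℝ) + 1 := fun k => by linarith [(Nat.cast_nonneg k : (0 : ℝ) ≤ k)]
  have hψd : ∀ k : ℕ, Differentiable ℝ (ψ ((k : ℝ) + 1)) := fun k => (hψ _ (hk1 k)).1.differentiable one_ne_zero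
  have hev : ∀ᶠ k : ℕ in atTop, ψ ((k : ℝ) + 1) x = 1 := by
    refine Filter.eventually_atTop.2 ⟨⌈‖x‖⌉₊, fun k hk => (hψ _ (hk1 k)).2.2.2.2.1 x ?_⟩
    have h1 : ‖x‖ ≤ (⌈‖x‖⌉₊ : ℝ) := Nat.le_ceil _
    have h2 : (⌈‖x‖⌉₊ : ℝ) ≤ k := by exact_mod_cast hk
    linarith
  refine ⟨?_, ?_, fun k => ?_, fun k => ?_⟩
  · exact (tendsto_const_nhds (x := φ x)).congr' (hev.mono fun k hk => by
      show φ x = ψ ((k : ℝ) + 1) x * φ x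
      rw [hk, one_mul])
  · -- `D(ψ_k φ) x = ψ_k x • Dφ x + φ x • Dψ_k x → Dφ x`
    have hD : ∀ k : ℕ, ‖fderiv ℝ (ψ ((k : ℝ) + 1)) x‖ ≤ K / ((k : ℝ) + 1) := fun k => (hψ _ (hk1 k)).2.2.2.2.2 x
    have hlim : Tendsto (fun k : ℕ => ψ ((k : ℝ) + 1) x • fderiv ℝ φ x + φ x • fderiv ℝ (ψ ((k : ℝ) + 1)) x) atTop
        (𝓝 (fderiv ℝ φ x)) := by
      rw [tendsto_iff_norm_sub_tendsto_zero]
      have hbound : ∀ᶠ k : ℕ in atTop,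
          ‖ψ ((k : ℝ) + 1) x • fderiv ℝ φ x + φ x • fderiv ℝ (ψ ((k : ℝ) + 1)) x - fderiv ℝ φ x‖ ≤ |φ x| * K * ((k : ℝ) + 1)⁻¹ := by
        refine hev.mono fun k hk => ?_
        rw [hk, one_smul, add_sub_cancel_left, norm_smul, Real.norm_eq_abs, mul_assoc]
        refine mul_le_mul_of_nonneg_left ?_ (abs_nonneg _)
        rw [← div_eq_mul_inv]
        exact hD k
      have hl : Tendsto (fun k : ℕ => |φ x| * K * ((k : ℝ) + 1)⁻¹) atTop (𝓝 0) := by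
        rw [show (0 : ℝ) = |φ x| * K * 0 by ring]
        exact tendsto_const_nhds.mul (tendsto_inv_atTop_zero.comp (tendsto_atTop_add_const_right _ 1 tendsto_natCast_atTop_atTop))
      exact squeeze_zero' (Eventually.of_forall fun k => norm_nonneg _) hbound hl
    have e : (fun k : ℕ => ψ ((k : ℝ) + 1) x • fderiv ℝ φ x + φ x • fderiv ℝ (ψ ((k : ℝ) + 1)) x) =
        fun k : ℕ => fderiv ℝ (fun y => ψ ((k : ℝ) + 1) y * φ y) x := by
      ext1 k; exact (fderiv_fun_mul (hψd k x) (hφd x)).symm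
    rw [e] at hlim
    exact hlim.norm
  · rw [abs_mul, abs_of_nonneg ((hψ _ (hk1 k)).2.2.1 x)]
    exact mul_le_of_le_one_left (abs_nonneg _) ((hψ _ (hk1 k)).2.2.2.1 x)
  · exact norm_fderiv_cutoff_mul_sq_le (hψd k x) (hφd x) ((hψ _ (hk1 k)).2.2.1 x) ((hψ _ (hk1 k)).2.2.2.1 x)
      (((hψ _ (hk1 k)).2.2.2.2.2 x).trans (div_le_self hK0 (hk1 k)))

/-- **THE GLUE — THE ENTROPY INEQUALITY FOR BOUNDED `C¹` TEST FUNCTIONS WITH BOUNDED DERIVATIVE** [folklore extension;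
cite: BakryGentilLedoux2014, Cor. 5.7.2].  `ν` a probability measure on `ℝⁿ` satisfying the `C¹_c` ENTROPY SCHEMA with constant `C`,
`∀ φ ∈ C¹_c, ∫ φ e^φ dν − (∫ e^φ dν)·log ∫ e^φ dν ≤ (C∕2) ∫ ‖Dφ‖² e^φ dν` (the shape of the tree's `entropy_exp_le_of_uniformlyConvex`
with `C = 1∕λ`; of the convex-DOMAIN port `…UniformlyConvexLogSobolevDomain.HasEntropyExpC1c ν C`, node00-def-RR-2); `φ ∈ C¹` with
`|φ| ≤ Mφ`, `‖Dφ‖ ≤ Lφ`.  Then the same inequality holds for `φ`.  Truncate `φ_k = ψ_{k+1}·φ ∈ C¹_c`, apply the schema, pass to the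
limit in the three integrals by dominated convergence (dominations `Mφ·e^{Mφ}`, `e^{Mφ}`, `(2Lφ² + 2K²Mφ²)·e^{Mφ}`). -/
theorem entropy_exp_le_of_entropyC1c {ν : Measure (EuclideanSpace ℝ (Fin n))} [IsProbabilityMeasure ν] {C : ℝ}
    (hEnt : ∀ φ : EuclideanSpace ℝ (Fin n) → ℝ, ContDiff ℝ 1 φ → HasCompactSupport φ →
      ∫ x, φ x * Real.exp (φ x) ∂ν - (∫ x, Real.exp (φ x) ∂ν) * Real.log (∫ x, Real.exp (φ x) ∂ν) ≤
        C / 2 * ∫ x, ‖fderiv ℝ φ x‖ ^ 2 * Real.exp (φ x) ∂ν)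
    {φ : EuclideanSpace ℝ (Fin n) → ℝ} {Mφ Lφ : ℝ} (hφ : ContDiff ℝ 1 φ) (hφb : ∀ x, |φ x| ≤ Mφ) (hφD : ∀ x, ‖fderiv ℝ φ x‖ ≤ Lφ) :
    ∫ x, φ x * Real.exp (φ x) ∂ν - (∫ x, Real.exp (φ x) ∂ν) * Real.log (∫ x, Real.exp (φ x) ∂ν) ≤
      C / 2 * ∫ x, ‖fderiv ℝ φ x‖ ^ 2 * Real.exp (φ x) ∂ν := by
  obtain ⟨ψ, K, hK0, hψ⟩ := exists_cutoff n
  have hk1 : ∀ k : ℕ, (1 : ℝ) ≤ (k : ℝ) + 1 := fun k => by linarith [(Nat.cast_nonneg k : (0 : ℝ) ≤ k)]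
  have hP := truncation_pointwise hK0 hψ hφ
  have hM0 : 0 ≤ Mφ := (abs_nonneg _).trans (hφb 0)
  set Φ : ℕ → EuclideanSpace ℝ (Fin n) → ℝ := fun k x => ψ ((k : ℝ) + 1) x * φ x with hΦ
  have hΦcd : ∀ k, ContDiff ℝ 1 (Φ k) := fun k => (hψ _ (hk1 k)).1.mul hφ
  have hΦcs : ∀ k, HasCompactSupport (Φ k) := fun k => (hψ _ (hk1 k)).2.1.mul_right
  have hΦb : ∀ k x, |Φ k x| ≤ Mφ := fun k x => ((hP x).2.2.1 k).trans (hφb x)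
  have heb : ∀ k x, Real.exp (Φ k x) ≤ Real.exp Mφ := fun k x => Real.exp_le_exp.2 ((le_abs_self _).trans (hΦb k x))
  have hineq : ∀ k, ∫ x, Φ k x * Real.exp (Φ k x) ∂ν - (∫ x, Real.exp (Φ k x) ∂ν) * Real.log (∫ x, Real.exp (Φ k x) ∂ν) ≤
      C / 2 * ∫ x, ‖fderiv ℝ (Φ k) x‖ ^ 2 * Real.exp (Φ k x) ∂ν := fun k => hEnt (Φ k) (hΦcd k) (hΦcs k)
  have hlimΦ : ∀ x, Tendsto (fun k => Φ k x) atTop (𝓝 (φ x)) := fun x => (hP x).1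
  have hlimE : ∀ x, Tendsto (fun k => Real.exp (Φ k x)) atTop (𝓝 (Real.exp (φ x))) := fun x =>
    (Real.continuous_exp.tendsto _).comp (hlimΦ x)
  -- (a) `∫ e^{Φ k} → ∫ e^φ`
  have limB : Tendsto (fun k => ∫ x, Real.exp (Φ k x) ∂ν) atTop (𝓝 (∫ x, Real.exp (φ x) ∂ν)) :=
    tendsto_integral_of_dominated_convergence (fun _ => Real.exp Mφ)
      (fun k => (Real.continuous_exp.comp (hΦcd k).continuous).aestronglyMeasurable) (integrable_const _)
      (fun k => Eventually.of_forall fun x => by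
        rw [Real.norm_eq_abs, abs_of_pos (Real.exp_pos _)]; exact heb k x)
      (Eventually.of_forall hlimE)
  -- (b) `∫ Φ k e^{Φ k} → ∫ φ e^φ`
  have limA : Tendsto (fun k => ∫ x, Φ k x * Real.exp (Φ k x) ∂ν) atTop (𝓝 (∫ x, φ x * Real.exp (φ x) ∂ν)) :=
    tendsto_integral_of_dominated_convergence (fun _ => Mφ * Real.exp Mφ)
      (fun k => ((hΦcd k).continuous.mul (Real.continuous_exp.comp (hΦcd k).continuous)).aestronglyMeasurable) (integrable_const _)
      (fun k => Eventually.of_forall fun x => by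
        rw [norm_mul, Real.norm_eq_abs, Real.norm_eq_abs, abs_of_pos (Real.exp_pos _)]
        exact mul_le_mul (hΦb k x) (heb k x) (Real.exp_pos _).le hM0)
      (Eventually.of_forall fun x => (hlimΦ x).mul (hlimE x))
  -- (c) `∫ ‖DΦ k‖² e^{Φ k} → ∫ ‖Dφ‖² e^φ`
  have limC : Tendsto (fun k => ∫ x, ‖fderiv ℝ (Φ k) x‖ ^ 2 * Real.exp (Φ k x) ∂ν) atTop
      (𝓝 (∫ x, ‖fderiv ℝ φ x‖ ^ 2 * Real.exp (φ x) ∂ν)) :=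
    tendsto_integral_of_dominated_convergence (fun _ => (2 * Lφ ^ 2 + 2 * K ^ 2 * Mφ ^ 2) * Real.exp Mφ)
      (fun k => ((((hΦcd k).continuous_fderiv one_ne_zero).norm.pow 2).mul
        (Real.continuous_exp.comp (hΦcd k).continuous)).aestronglyMeasurable) (integrable_const _)
      (fun k => Eventually.of_forall fun x => by
        rw [norm_mul, Real.norm_eq_abs, Real.norm_eq_abs, abs_of_nonneg (sq_nonneg _), abs_of_pos (Real.exp_pos _)]
        have h1 : ‖fderiv ℝ (Φ k) x‖ ^ 2 ≤ 2 * Lφ ^ 2 + 2 * K ^ 2 * Mφ ^ 2 := by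
          refine ((hP x).2.2.2 k).trans ?_
          have a := pow_le_pow_left₀ (norm_nonneg _) (hφD x) 2
          have b : φ x ^ 2 ≤ Mφ ^ 2 := by
            rw [← sq_abs (φ x)]; exact pow_le_pow_left₀ (abs_nonneg _) (hφb x) 2
          nlinarith [sq_nonneg K]
        exact mul_le_mul h1 (heb k x) (Real.exp_pos _).le (by positivity))
      (Eventually.of_forall fun x => (((hP x).2.1).pow 2).mul (hlimE x))
  have hBpos : 0 < ∫ x, Real.exp (φ x) ∂ν :=
    integral_exp_pos (integrable_of_norm_le_const (Real.continuous_exp.comp hφ.continuous).aestronglyMeasurable (Real.exp Mφ)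
      fun x => by
        rw [Real.norm_eq_abs, abs_of_pos (Real.exp_pos _)]
        exact Real.exp_le_exp.2 ((le_abs_self _).trans (hφb x)))
  have limL : Tendsto (fun k => ∫ x, Φ k x * Real.exp (Φ k x) ∂ν - (∫ x, Real.exp (Φ k x) ∂ν) * Real.log (∫ x, Real.exp (Φ k x) ∂ν))
      atTop (𝓝 (∫ x, φ x * Real.exp (φ x) ∂ν - (∫ x, Real.exp (φ x) ∂ν) * Real.log (∫ x, Real.exp (φ x) ∂ν))) :=
    limA.sub (limB.mul ((Real.continuousAt_log hBpos.ne').tendsto.comp limB))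
  exact le_of_tendsto_of_tendsto' limL (limC.const_mul _) hineq
end Glue

/-! ## §2 Herbst under the entropy schema: sub-Gaussian law and second-order born cumulant, GRADIENT constant -/
section Herbst

variable {ν : Measure (EuclideanSpace ℝ (Fin n))} [IsProbabilityMeasure ν] {C : ℝ} {G : EuclideanSpace ℝ (Fin n) → ℝ} {B L : ℝ}

/-- **HERBST'S HYPOTHESIS FROM THE SCHEMA** [folklore ∘ cite: BakryGentilLedoux2014, Prop. 5.4.1].  `ν` a probability measure on `ℝⁿ`
with the `C¹_c` entropy schema of constant `C ≥ 0`; `G ∈ C¹` with `|G| ≤ B`, `‖DG‖ ≤ L`.  Then for EVERY real `l`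
`Ent_ν(e^{lG}) = ∫ e^{lG}·lG dν − (∫ e^{lG} dν)·log ∫ e^{lG} dν ≤ (C·L²∕2)·l²·∫ e^{lG} dν` — the displayed input of
`Literature.Probability.Moments.hasSubgaussianMGF_of_entropy_le` with `c = C·L²∕2` (glue §1 applied to `φ = l·G`, then `‖D(lG)‖² ≤ l²L²`). -/
theorem entropy_exp_mul_le_of_entropyC1c (hC : 0 ≤ C)
    (hEnt : ∀ φ : EuclideanSpace ℝ (Fin n) → ℝ, ContDiff ℝ 1 φ → HasCompactSupport φ →
      ∫ x, φ x * Real.exp (φ x) ∂ν - (∫ x, Real.exp (φ x) ∂ν) * Real.log (∫ x, Real.exp (φ x) ∂ν) ≤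
        C / 2 * ∫ x, ‖fderiv ℝ φ x‖ ^ 2 * Real.exp (φ x) ∂ν)
    (hG : ContDiff ℝ 1 G) (hGb : ∀ x, |G x| ≤ B) (hGD : ∀ x, ‖fderiv ℝ G x‖ ≤ L) (l : ℝ) :
    ∫ x, Real.exp (l * G x) * (l * G x) ∂ν - (∫ x, Real.exp (l * G x) ∂ν) * Real.log (∫ x, Real.exp (l * G x) ∂ν) ≤
      C * L ^ 2 / 2 * l ^ 2 * ∫ x, Real.exp (l * G x) ∂ν := by
  have hGd : Differentiable ℝ G := hG.differentiable one_ne_zero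
  -- `φ = l·G` is bounded `C¹` with `‖Dφ‖ ≤ |l|·L`
  have hφ : ContDiff ℝ 1 (fun x => l * G x) := contDiff_const.mul hG
  have hφb : ∀ x, |l * G x| ≤ |l| * B := fun x => by
    rw [abs_mul]; exact mul_le_mul_of_nonneg_left (hGb x) (abs_nonneg _)
  have hφD : ∀ x, ‖fderiv ℝ (fun y => l * G y) x‖ ≤ |l| * L := fun x => by
    rw [fderiv_const_mul (hGd x), norm_smul, Real.norm_eq_abs]
    exact mul_le_mul_of_nonneg_left (hGD x) (abs_nonneg _)
  have key := entropy_exp_le_of_entropyC1c hEnt hφ hφb hφD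
  -- compare the right-hand sides pointwise: `‖D(lG)‖² e^{lG} ≤ l²L² e^{lG}`
  have hint : Integrable (fun x => Real.exp (l * G x)) ν :=
    Literature.Probability.Moments.integrable_exp_mul_of_abs_le_const ν hG.continuous.measurable hGb l
  have hrhs : ∫ x, ‖fderiv ℝ (fun y => l * G y) x‖ ^ 2 * Real.exp (l * G x) ∂ν ≤ ∫ x, (l ^ 2 * L ^ 2) * Real.exp (l * G x) ∂ν := by
    refine integral_mono_of_nonneg (Eventually.of_forall fun x => by positivity) (hint.const_mul _) (Eventually.of_forall fun x => ?_)
    have h1 : ‖fderiv ℝ (fun y => l * G y) x‖ ^ 2 ≤ (|l| * L) ^ 2 := pow_le_pow_left₀ (norm_nonneg _) (hφD x) 2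
    rw [mul_pow, sq_abs] at h1
    exact mul_le_mul_of_nonneg_right h1 (Real.exp_pos _).le
  have e1 : ∫ x, (l * G x) * Real.exp (l * G x) ∂ν = ∫ x, Real.exp (l * G x) * (l * G x) ∂ν :=
    integral_congr_ae (Eventually.of_forall fun x => by simp only; ring)
  rw [e1] at key
  refine key.trans ?_
  rw [integral_const_mul] at hrhs
  have h2 := mul_le_mul_of_nonneg_left hrhs (show (0 : ℝ) ≤ C / 2 by positivity)
  refine h2.trans (le_of_eq ?_)
  ring

/-- **THE SUB-GAUSSIAN FIBRE LAW FROM THE SCHEMA** (Herbst) [cite: BakryGentilLedoux2014, Prop. 5.4.1 — PROVED in the tree as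
`hasSubgaussianMGF_of_entropy_le`].  Under a probability law `ν` on `ℝⁿ` with the `C¹_c` entropy schema of constant `C > 0`, a `C¹`
observable with `|G| ≤ B` and gradient size `‖DG‖ ≤ L` (`L > 0`) is sub-Gaussian about its mean with parameter `C·L²`:
`HasSubgaussianMGF (G − ∫G dν) ⟨C·L²⟩ ν` — the INPUT of `YMDAG.N14.CovGradEngine.bornCumulant_le_of_hasSubgaussianMGF` (LENS control card 1
C1-a), PRODUCED.  (Guionnet 2009 Lemma 4.2: `LSI(c)`, `|G|_L = L` ⇒ parameter `c·L²`.) -/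
theorem hasSubgaussianMGF_of_entropyC1c (hC : 0 < C)
    (hEnt : ∀ φ : EuclideanSpace ℝ (Fin n) → ℝ, ContDiff ℝ 1 φ → HasCompactSupport φ →
      ∫ x, φ x * Real.exp (φ x) ∂ν - (∫ x, Real.exp (φ x) ∂ν) * Real.log (∫ x, Real.exp (φ x) ∂ν) ≤
        C / 2 * ∫ x, ‖fderiv ℝ φ x‖ ^ 2 * Real.exp (φ x) ∂ν)
    (hG : ContDiff ℝ 1 G) (hGb : ∀ x, |G x| ≤ B) (hGD : ∀ x, ‖fderiv ℝ G x‖ ≤ L) (hL : 0 < L) :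
    HasSubgaussianMGF (fun x => G x - ∫ z, G z ∂ν) ⟨C * L ^ 2, by positivity⟩ ν := by
  have hc : 0 < C * L ^ 2 / 2 := by positivity
  have h := hasSubgaussianMGF_of_entropy_le ν hG.continuous.measurable hGb hc
    (entropy_exp_mul_le_of_entropyC1c hC.le hEnt hG hGb hGD)
  have e : (⟨2 * (C * L ^ 2 / 2), (mul_pos two_pos hc).le⟩ : ℝ≥0) = ⟨C * L ^ 2, by positivity⟩ := by
    ext
    push_cast
    ring
  rwa [e] at h

/-- **THE BORN DRESSED CUMULANT IS SECOND ORDER WITH THE GRADIENT CONSTANT** (this node's currency) [folklore ∘ cite: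
BakryGentilLedoux2014, Prop. 5.4.1].  Under the schema of constant `C > 0`, for a `C¹` observable with `|G| ≤ B`, `‖DG‖ ≤ L`, `L > 0`:
`cgf G ν t − t·∫G dν ≤ (C·L²)·t²∕2` for EVERY real `t` (no window) — by generation 3's `bornCumulant_le_of_hasSubgaussianMGF`.  Compare the
sup-currency of `(1.75)ₜ`, `‖D_t − t·E₀W‖ ≤ 2B²e^{6(s+|t|B)}·|t|²` (`B16DressedActionTerm.norm_dressLog_sub_linear_le`): here the constant
is the observable's GRADIENT size squared times the schema constant — the letter in which a depth-`k` fibre's observable is `θ₁^k`-small. -/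
theorem bornCumulant_le_of_entropyC1c (hC : 0 < C)
    (hEnt : ∀ φ : EuclideanSpace ℝ (Fin n) → ℝ, ContDiff ℝ 1 φ → HasCompactSupport φ →
      ∫ x, φ x * Real.exp (φ x) ∂ν - (∫ x, Real.exp (φ x) ∂ν) * Real.log (∫ x, Real.exp (φ x) ∂ν) ≤
        C / 2 * ∫ x, ‖fderiv ℝ φ x‖ ^ 2 * Real.exp (φ x) ∂ν)
    (hG : ContDiff ℝ 1 G) (hGb : ∀ x, |G x| ≤ B) (hGD : ∀ x, ‖fderiv ℝ G x‖ ≤ L) (hL : 0 < L) (t : ℝ) :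
    cgf G ν t - t * ∫ z, G z ∂ν ≤ C * L ^ 2 * t ^ 2 / 2 := by
  have h := bornCumulant_le_of_hasSubgaussianMGF (hasSubgaussianMGF_of_entropyC1c hC hEnt hG hGb hGD hL) t
  exact_mod_cast h
end Herbst

/-! ## §3 The uniformly log-concave fibre law on `ℝⁿ`: the schema with `C = 1∕λ`, Herbst currency `L²∕λ`, Brascamp–Lieb variance -/
section Convex

variable {V G : EuclideanSpace ℝ (Fin n) → ℝ} {lam B L : ℝ}

/-- **THE SCHEMA HOLDS FOR THE UNIFORMLY LOG-CONCAVE LAW** with constant `1∕λ` [cite: BakryGentilLedoux2014, Cor. 5.7.2 — the tree's PROVED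
`entropy_exp_le_of_uniformlyConvex` (Bobkov–Ledoux's form), restated in the schema's normal form `C∕2`, `C = 1∕λ`]. -/
theorem entropyC1c_of_uniformlyConvex (hlam : 0 < lam) (hVc : Continuous V)
    (hV : ∀ x y : EuclideanSpace ℝ (Fin n), V x + ⟪gradient V x, y - x⟫ + lam / 2 * ‖y - x‖ ^ 2 ≤ V y)
    (hZ : Integrable fun x => Real.exp (-V x)) (φ : EuclideanSpace ℝ (Fin n) → ℝ) (hφ : ContDiff ℝ 1 φ) (hφs : HasCompactSupport φ) :
    ∫ x, φ x * Real.exp (φ x) ∂(volume.tilted fun x => -V x) -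
        (∫ x, Real.exp (φ x) ∂(volume.tilted fun x => -V x)) * Real.log (∫ x, Real.exp (φ x) ∂(volume.tilted fun x => -V x)) ≤
      (1 / lam) / 2 * ∫ x, ‖fderiv ℝ φ x‖ ^ 2 * Real.exp (φ x) ∂(volume.tilted fun x => -V x) := by
  have h := entropy_exp_le_of_uniformlyConvex (G := gradient V) hlam hVc hV hZ hφ hφs
  rwa [show (1 : ℝ) / (2 * lam) = (1 / lam) / 2 by field_simp] at h

/-- **THE SUB-GAUSSIAN FIBRE LAW FROM THE MODULUS** (Herbst ∘ Bakry–Émery, both PROVED in the tree).  Under `ν = e^{−V}dx∕Z` with `V`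
`λ`-uniformly convex, a `C¹` observable with `|G| ≤ B`, `‖DG‖ ≤ L`, `L > 0` has `HasSubgaussianMGF (G − ∫G dν) ⟨L²∕λ⟩ ν`
(Guionnet 2009 Lemma 4.2 with `c = 1∕λ`). [cite: BakryGentilLedoux2014, Prop. 5.4.1] -/
theorem hasSubgaussianMGF_of_uniformlyConvex (hlam : 0 < lam) (hVc : Continuous V)
    (hV : ∀ x y : EuclideanSpace ℝ (Fin n), V x + ⟪gradient V x, y - x⟫ + lam / 2 * ‖y - x‖ ^ 2 ≤ V y)
    (hZ : Integrable fun x => Real.exp (-V x)) (hG : ContDiff ℝ 1 G) (hGb : ∀ x, |G x| ≤ B) (hGD : ∀ x, ‖fderiv ℝ G x‖ ≤ L)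
    (hL : 0 < L) :
    HasSubgaussianMGF (fun x => G x - ∫ z, G z ∂(volume.tilted fun x => -V x)) ⟨L ^ 2 / lam, by positivity⟩
      (volume.tilted fun x => -V x) := by
  haveI : IsProbabilityMeasure ((volume : Measure (EuclideanSpace ℝ (Fin n))).tilted fun x => -V x) :=
    isProbabilityMeasure_tilted_neg hZ
  have h := hasSubgaussianMGF_of_entropyC1c (one_div_pos.2 hlam) (entropyC1c_of_uniformlyConvex hlam hVc hV hZ) hG hGb hGD hL
  have e : (⟨1 / lam * L ^ 2, by positivity⟩ : ℝ≥0) = ⟨L ^ 2 / lam, by positivity⟩ := by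
    ext
    push_cast
    ring
  rwa [e] at h

/-- **THE BORN DRESSED CUMULANT OF ONE CONVEX FIBRE** [folklore ∘ cite: BakryGentilLedoux2014, Prop. 5.4.1]: under `ν = e^{−V}dx∕Z`
with `V` `λ`-uniformly convex, for a `C¹` observable with `|G| ≤ B`, `‖DG‖ ≤ L`, `L > 0`: `cgf G ν t − t·∫G dν ≤ (L²∕λ)·t²∕2` for EVERY
real `t` — SECOND ORDER in the source with the GRADIENT constant, dimension-free and background-free. -/
theorem bornCumulant_le_of_uniformlyConvex (hlam : 0 < lam) (hVc : Continuous V)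
    (hV : ∀ x y : EuclideanSpace ℝ (Fin n), V x + ⟪gradient V x, y - x⟫ + lam / 2 * ‖y - x‖ ^ 2 ≤ V y)
    (hZ : Integrable fun x => Real.exp (-V x)) (hG : ContDiff ℝ 1 G) (hGb : ∀ x, |G x| ≤ B) (hGD : ∀ x, ‖fderiv ℝ G x‖ ≤ L)
    (hL : 0 < L) (t : ℝ) :
    cgf G (volume.tilted fun x => -V x) t - t * ∫ z, G z ∂(volume.tilted fun x => -V x) ≤ L ^ 2 / lam * t ^ 2 / 2 := by
  haveI : IsProbabilityMeasure ((volume : Measure (EuclideanSpace ℝ (Fin n))).tilted fun x => -V x) :=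
    isProbabilityMeasure_tilted_neg hZ
  have h := bornCumulant_le_of_hasSubgaussianMGF (hasSubgaussianMGF_of_uniformlyConvex hlam hVc hV hZ hG hGb hGD hL) t
  exact_mod_cast h

/-- **THE VARIANCE LETTER** [cite: BrascampLieb1976, Thm 4.1 — PROVED in the tree as `variance_tilted_le`].  Under the `λ`-uniformly
log-concave fibre law `ν = e^{−V}dx∕Z`, a `C¹` observable with `|G| ≤ B`, `‖DG‖ ≤ L` has `Var[G; ν] ≤ λ⁻¹·L²` — the scalar
(one-bond) case of `CovGradEngine.var_le_of_covGradBound`'s currency, produced. -/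
theorem variance_le_of_uniformlyConvex (hlam : 0 < lam) (hVc : Continuous V)
    (hV : ∀ x y : EuclideanSpace ℝ (Fin n), V x + ⟪gradient V x, y - x⟫ + lam / 2 * ‖y - x‖ ^ 2 ≤ V y)
    (hZ : Integrable fun x => Real.exp (-V x)) (hG : ContDiff ℝ 1 G) (hGb : ∀ x, |G x| ≤ B) (hGD : ∀ x, ‖fderiv ℝ G x‖ ≤ L) :
    Var[G; volume.tilted fun x => -V x] ≤ lam⁻¹ * L ^ 2 := by
  set ν : Measure (EuclideanSpace ℝ (Fin n)) := volume.tilted fun x => -V x with hν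
  haveI : IsProbabilityMeasure ν := isProbabilityMeasure_tilted_neg hZ
  have hB0 : 0 ≤ B := (abs_nonneg _).trans (hGb 0)
  have hGm : AEStronglyMeasurable G ν := hG.continuous.aestronglyMeasurable
  have hbdd : ∀ᵐ x ∂ν, G x ∈ Set.Icc (-B) B := Eventually.of_forall fun x => abs_le.1 (hGb x)
  have hLp : MemLp G 2 ν := memLp_of_bounded hbdd hGm 2
  have h1 : Integrable G ν := hLp.integrable one_le_two
  have h2 : Integrable (fun x => G x ^ 2) ν :=
    integrable_of_norm_le_const (hG.continuous.pow 2).aestronglyMeasurable (B ^ 2) fun x => by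
      rw [Real.norm_eq_abs, abs_of_nonneg (sq_nonneg _), ← sq_abs]
      exact pow_le_pow_left₀ (abs_nonneg _) (hGb x) 2
  have hDc : Continuous fun x => ‖fderiv ℝ G x‖ := (hG.continuous_fderiv one_ne_zero).norm
  have h3 : Integrable (fun x => ‖fderiv ℝ G x‖ ^ 2) ν :=
    integrable_of_norm_le_const (hDc.pow 2).aestronglyMeasurable (L ^ 2) fun x => by
      rw [Real.norm_eq_abs, abs_of_nonneg (sq_nonneg _)]
      exact pow_le_pow_left₀ (norm_nonneg _) (hGD x) 2
  have key := variance_tilted_le hlam hVc hV hZ hG h1 h2 h3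
  have hI : ∫ x, ‖fderiv ℝ G x‖ ^ 2 ∂ν ≤ L ^ 2 := by
    have h := integral_mono h3 (integrable_const (L ^ 2)) fun x => pow_le_pow_left₀ (norm_nonneg _) (hGD x) 2
    simpa using h
  have hv : Var[G; ν] = ∫ x, G x ^ 2 ∂ν - (∫ x, G x ∂ν) ^ 2 := by
    rw [variance_eq_sub hLp]
    rfl
  rw [hv]
  exact key.trans (mul_le_mul_of_nonneg_left hI (inv_pos.2 hlam).le)
end Convex

end YMDAG.N14.ConvexFibreEngine

end
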